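import Summits.BirchSwinnertonDyer.BirchSwinnertonDyer.Theorems.ThetaPartnerAtTwoSignedKatoUpToAtTwoLocalTowerGeneration
import Summits.BirchSwinnertonDyer.BirchSwinnertonDyer.Theorems.ThetaPartnerAtTwoSignedControlAtTwoPlusTowerStepTwo
import Summits.BirchSwinnertonDyer.BirchSwinnertonDyer.Theorems.ThetaPartnerAtTwoSignedControlAtTwoOmegaSubfieldDefs
import HarnessLib

/-!
# The PLUS tower at `2`, V: KOBAYASHI'S GENERATION STEP ALONG THE PLUS TOWER (`Prop. 8.11 ⇒ 8.12` for
# `k' = ℚ₂(v_{N+1}) ⊃ k = ℚ₂(v_N)`, `p = 2`), at the level of logarithms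
# (K4 `SignedControlAtTwo`, stmt-BirchSwinnertonDyer-20309, line `eulerchar` v6, stub HONDA⁺@2 (GEN) — memo LAGPLUS-AT-2 §4)

Route `ThetaPartnerAtTwo` (TP2; shared with `ResidualThetaTransportAtTwo`), crux K4, lead seat `prover-bsd-wall-tp2-p3` (g2). PORT of the K3
lead's all-primes generation step `…SignedKatoUpToAtTwoLocalTowerGeneration.exists_sub_closure_sub_smul_mem'` ([K] Prop. 8.11 ⇒ 8.12 ii)
along `ℚ_p(ζ_{p^m})`) to the PLUS layers `ℚ₂(ζ_{2^N} + ζ_{2^N}⁻¹)` at `p = 2`: its tower inputs are replaced by the plus-tower algebra of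
files I–IV (`frob_layerField'` ↦ FROB⁺ `exists_norm_sq_sub_le`; `exists_sub_pow_mul_mem_closure_sup` ↦ TGEN `exists_mem_closure_pow_sigma_add`,
from the tower lemma `(T)`); the generic inputs (Honda points at every prime `exists_mem_norm_ptLog_sub_le_one'`, local surjectivity
`exists_ptLog_eq`, `Λ`'s additivity / Galois equivariance on `Ω`-points) are used as they stand, inside the complete field `OmegaSubfield 2 k'`.
WHAT (`M/ℤ₂`, elliptic fibres, `a₂(M) = 0`; `E = genFibΩ 2 M`, `E₁ = kernel`, `Λ = ptLogΩ`; `v_N = ζ_{2^N} + ζ_{2^N}⁻¹ − 2`, `N ≥ 2`; `L(F)` =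
points with coordinates in `F`): §1 `Γ`-stability of the plus fields and their points; §2 transport `E(OmegaSubfield 2 F) → E(Ω)` and
`Λ_Ω ∘ toOmega = Λ` (O10 `PadicLayerTransport` §1–§2 with `layer p m` ↦ any finite `F`); §3 `exists_closure_pt_plus` (closure correspondence:
`ℤ[Γ·v_{N+1}] ⊆ Λ(ℤ[Γ·e]) + k` for `e ∈ L(k') ∩ E₁` with `Λ(e) − v_{N+1} ∈ k`); §4 **`exists_sub_closure_sub_two_smul_plus`**: for such `e` and
every `P ∈ L(k') ∩ E₁` there are `B ∈ ℤ[Γ·e]`, `R ∈ L(k') ∩ E₁` with `Λ(P − B − 2•R) ∈ k` (descent to `L(k)`: file VI).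
HONEST FRAMING: THEOREMS ONLY (no definition, no named fact, no instance, no `sorry`); pure local formal-group theory; nothing about any Selmer
group; closes no item; BSD is not proved by any of this. The plus Honda point `e` is a HYPOTHESIS here.

References: [Kobayashi2003] §8.4, Props. 8.11–8.12; [SilvermanAEC2009] IV.6.4, VII.2.2; [SerreLocalFields1979] Ch. IV §4.
-/

set_option autoImplicit false
-- the Theorems namespace of this sub repeats the summit name by design (D-0017 nested layout)
set_option linter.dupNamespace false

noncomputable section

open scoped Classical Topology NNReal IntermediateField
open Filter PowerSeries Finset Polynomial

namespace Summit.BirchSwinnertonDyer.BirchSwinnertonDyer.Theorems.SignedEC.PlusTower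

open Literature.RingTheory.FormalGroups WeierstrassCurve Field Field.absoluteGaloisGroup
open Summit.BirchSwinnertonDyer.Rank1Residual.Additive
open Summit.BirchSwinnertonDyer.Rank1Residual.Additive.PadicCyclotomicTower
open Summit.BirchSwinnertonDyer.Rank1Residual.Additive.HondaFss
open Summit.BirchSwinnertonDyer.Rank1Residual.Additive.BallEval
open Literature.NumberTheory.GaloisRepresentations.LubinTate (unitBall mem_unitBall_iff)
open Literature.NumberTheory.EllipticCurves Literature.NumberTheory.EllipticCurves.FormalGroupChart
open Summit.BirchSwinnertonDyer.BirchSwinnertonDyer.Theorems.SignedKatoOffTwo.LocalAllPrimes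
open Summit.BirchSwinnertonDyer.BirchSwinnertonDyer.Theorems.SignedEC.OmegaSubfield

/-! ## §1 The plus fields inside the layers; `Γ`-stability -/

/-- `ℚ₂(v_M) ≤ layer 2 M = ℚ₂(ζ_{2^M})`. [folklore] -/
theorem adjoin_v_le_layer (M : ℕ) : ℚ_[2]⟮zeta 2 M + (zeta 2 M)⁻¹ - 2⟯ ≤ layer 2 M := by
  rw [IntermediateField.adjoin_simple_le_iff]
  have hz := zeta_mem_layer 2 M
  exact sub_mem (add_mem hz (inv_mem hz)) (by exact_mod_cast IntermediateField.natCast_mem (layer 2 M) 2)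

/-- `x^a + x^{−a} ∈ K` whenever `x + x⁻¹ ∈ K` (Chebyshev recursion). [folklore] -/
theorem pow_add_inv_pow_mem {x : PadicAlgCl 2} (hx : x ≠ 0) {K : IntermediateField ℚ_[2] (PadicAlgCl 2)}
    (hu : x + x⁻¹ ∈ K) (a : ℕ) : x ^ a + (x ^ a)⁻¹ ∈ K := by
  have key : ∀ b : ℕ, x ^ b + (x ^ b)⁻¹ ∈ K ∧ x ^ (b + 1) + (x ^ (b + 1))⁻¹ ∈ K := by
    intro b
    induction b with
    | zero =>
      exact ⟨by rw [pow_zero, inv_one]; exact add_mem (one_mem K) (one_mem K), by rw [pow_one]; exact hu⟩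
    | succ b ih =>
      refine ⟨ih.2, ?_⟩
      have e : x ^ (b + 1 + 1) + (x ^ (b + 1 + 1))⁻¹ =
          (x ^ (b + 1) + (x ^ (b + 1))⁻¹) * (x + x⁻¹) - (x ^ b + (x ^ b)⁻¹) := by
        field_simp
        ring
      rw [e]; exact sub_mem (mul_mem ih.2 hu) ih.1
  exact (key a).1

/-- **`Γ` preserves `v_M` up to `ℚ₂(v_M)`**: `σ • v_M ∈ ℚ₂(v_M)` (`σζ = ζ^c`, `ζ^c + ζ^{−c} ∈ ℤ[ζ + ζ⁻¹]`). [folklore] -/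
theorem smul_v_mem (σ : absoluteGaloisGroup ℚ_[2]) (M : ℕ) :
    σ • (zeta 2 M + (zeta 2 M)⁻¹ - 2) ∈ ℚ_[2]⟮zeta 2 M + (zeta 2 M)⁻¹ - 2⟯ := by
  set K := ℚ_[2]⟮zeta 2 M + (zeta 2 M)⁻¹ - 2⟯ with hK
  have h2K : (2 : PadicAlgCl 2) ∈ K := by exact_mod_cast IntermediateField.natCast_mem K 2
  have huK : zeta 2 M + (zeta 2 M)⁻¹ ∈ K := by
    have h := IntermediateField.mem_adjoin_simple_self ℚ_[2] (zeta 2 M + (zeta 2 M)⁻¹ - 2)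
    have e : zeta 2 M + (zeta 2 M)⁻¹ = (zeta 2 M + (zeta 2 M)⁻¹ - 2) + 2 := by ring
    rw [e]; exact add_mem h h2K
  obtain ⟨c, -, hc⟩ := exists_apply_zeta_eq_pow 2 (toAlgEquiv ℚ_[2] σ) M
  rw [absoluteGaloisGroup.smul_def, map_sub, apply_u_of_apply_zeta hc, map_ofNat]
  exact sub_mem (pow_add_inv_pow_mem (zeta_ne_zero M) huK c) h2K

/-- **`ℚ₂(v_M)` is `Γ`-stable** (`M ≥ 2`). [folklore] -/
theorem smul_mem_adjoin_v {M : ℕ} (hM : 2 ≤ M) (σ : absoluteGaloisGroup ℚ_[2]) {x : PadicAlgCl 2}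
    (hx : x ∈ ℚ_[2]⟮zeta 2 M + (zeta 2 M)⁻¹ - 2⟯) : σ • x ∈ ℚ_[2]⟮zeta 2 M + (zeta 2 M)⁻¹ - 2⟯ := by
  have hv := smul_v_mem σ M
  rw [absoluteGaloisGroup.smul_def] at hv
  obtain ⟨r, -, rfl⟩ := exists_aeval_v_eq hM hx
  rw [absoluteGaloisGroup.smul_def, aeval_eq_sum_range, map_sum]
  refine sum_mem fun i _ ↦ ?_
  rw [Algebra.smul_def, map_mul, map_pow, AlgEquiv.commutes]
  exact mul_mem (IntermediateField.algebraMap_mem _ _) (pow_mem hv i)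

/-- The coefficients of `E_Ω` lie in every intermediate field (they lie in `ℚ₂`). [folklore] -/
theorem coeffs_mem_adjoin (M : WeierstrassCurve ℤ_[2]) (K : IntermediateField ℚ_[2] (PadicAlgCl 2)) :
    (genFibΩ 2 M).a₁ ∈ K.toSubfield ∧ (genFibΩ 2 M).a₂ ∈ K.toSubfield ∧ (genFibΩ 2 M).a₃ ∈ K.toSubfield ∧
      (genFibΩ 2 M).a₄ ∈ K.toSubfield ∧ (genFibΩ 2 M).a₆ ∈ K.toSubfield := by
  simp only [genFibΩ, baseChange, map_a₁, map_a₂, map_a₃, map_a₄, map_a₆]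
  exact ⟨IntermediateField.algebraMap_mem _ _, IntermediateField.algebraMap_mem _ _, IntermediateField.algebraMap_mem _ _,
    IntermediateField.algebraMap_mem _ _, IntermediateField.algebraMap_mem _ _⟩

/-- Points with coordinates in `S` have coordinates in any `S' ≥ S`. [folklore] -/
theorem mem_subfieldPoints_of_le {V : WeierstrassCurve (PadicAlgCl 2)} {S S' : Subfield (PadicAlgCl 2)}
    (hS : V.a₁ ∈ S ∧ V.a₂ ∈ S ∧ V.a₃ ∈ S ∧ V.a₄ ∈ S ∧ V.a₆ ∈ S)
    (hS' : V.a₁ ∈ S' ∧ V.a₂ ∈ S' ∧ V.a₃ ∈ S' ∧ V.a₄ ∈ S' ∧ V.a₆ ∈ S') (hle : S ≤ S')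
    {Q : V.toAffine.Point} (hQ : Q ∈ subfieldPoints V S hS) : Q ∈ subfieldPoints V S' hS' := by
  rcases Q with _ | ⟨x, y, h⟩
  · exact (subfieldPoints V S' hS').zero_mem
  · obtain ⟨hx, hy⟩ := (some_mem_subfieldPoints_iff hS h).mp hQ
    exact (some_mem_subfieldPoints_iff hS' h).mpr ⟨hle hx, hle hy⟩

/-- A coordinatewise Galois action preserves the points of `L(ℚ₂(v_M))` (`M ≥ 2`). [folklore] -/
theorem act_mem_subfieldPoints_adjoin_v {M : WeierstrassCurve ℤ_[2]}
    (act : absoluteGaloisGroup ℚ_[2] → (genFibΩ 2 M).toAffine.Point → (genFibΩ 2 M).toAffine.Point)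
    (hact0 : ∀ σ, act σ 0 = 0)
    (hact : ∀ σ (x y : PadicAlgCl 2) (h : (genFibΩ 2 M).toAffine.Nonsingular x y),
      ∃ h', act σ (Affine.Point.some x y h) = Affine.Point.some (σ • x) (σ • y) h')
    (σ : absoluteGaloisGroup ℚ_[2]) {N : ℕ} (hN : 2 ≤ N) {Q : (genFibΩ 2 M).toAffine.Point}
    (hQ : Q ∈ subfieldPoints (genFibΩ 2 M) (ℚ_[2]⟮zeta 2 N + (zeta 2 N)⁻¹ - 2⟯).toSubfield
      (coeffs_mem_adjoin M _)) :
    act σ Q ∈ subfieldPoints (genFibΩ 2 M) (ℚ_[2]⟮zeta 2 N + (zeta 2 N)⁻¹ - 2⟯).toSubfield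
      (coeffs_mem_adjoin M _) := by
  rcases Q with _ | ⟨x, y, h⟩
  · change act σ 0 ∈ _
    rw [hact0]; exact (subfieldPoints _ _ _).zero_mem
  · obtain ⟨h', e⟩ := hact σ x y h
    obtain ⟨hx, hy⟩ := (some_mem_subfieldPoints_iff _ h).mp hQ
    rw [e, some_mem_subfieldPoints_iff]
    exact ⟨smul_mem_adjoin_v hN σ hx, smul_mem_adjoin_v hN σ hy⟩

/-! ## §2 Transport between a finite subfield `F ⊂ Ω` (the type `OmegaSubfield 2 F`) and `Ω` -/

section Transport

variable {M : WeierstrassCurve ℤ_[2]} {F : IntermediateField ℚ_[2] (PadicAlgCl 2)}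

/-- `z(toOmega P) = z(P)`. [folklore] -/
theorem zCoord_toOmegaF (P : (curveK 2 (OmegaSubfield 2 F) M).toAffine.Point) :
    (toOmega 2 F M P).zCoord = emb 2 F P.zCoord := by
  rcases P with _ | ⟨x, y, h⟩
  · change (0 : (genFibΩ 2 M).toAffine.Point).zCoord =
      emb 2 F (0 : (curveK 2 (OmegaSubfield 2 F) M).toAffine.Point).zCoord
    rw [Affine.Point.zCoord_zero, Affine.Point.zCoord_zero, map_zero]
  · rw [OmegaSubfield.toOmega_some, Affine.Point.zCoord_some, Affine.Point.zCoord_some, map_div₀, map_neg]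

/-- The image of `toOmega` consists of points with coordinates in `F`. [folklore] -/
theorem toOmegaF_mem_subfieldPoints (P : (curveK 2 (OmegaSubfield 2 F) M).toAffine.Point) :
    toOmega 2 F M P ∈ subfieldPoints (genFibΩ 2 M) F.toSubfield (coeffs_mem_adjoin M F) := by
  rcases P with _ | ⟨x, y, h⟩
  · exact (subfieldPoints _ _ _).zero_mem
  · rw [OmegaSubfield.toOmega_some, some_mem_subfieldPoints_iff]
    exact ⟨emb_mem x, emb_mem y⟩

/-- **Every `Ω`-point with coordinates in `F` is in the image of `toOmega`.** [folklore] -/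
theorem exists_toOmegaF_eq {Q : (genFibΩ 2 M).toAffine.Point}
    (hQ : Q ∈ subfieldPoints (genFibΩ 2 M) F.toSubfield (coeffs_mem_adjoin M F)) :
    ∃ P : (curveK 2 (OmegaSubfield 2 F) M).toAffine.Point, toOmega 2 F M P = Q := by
  rcases Q with _ | ⟨x, y, h⟩
  · exact ⟨0, rfl⟩
  · obtain ⟨hx, hy⟩ := (some_mem_subfieldPoints_iff _ h).mp hQ
    exact ⟨.some _ _ (nonsingular_mk hx hy h), rfl⟩

variable [hintΩ : (genFibΩ 2 M).IsIntegral (Valued.v (R := PadicAlgCl 2)).integer]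
  [hint : (curveK 2 (OmegaSubfield 2 F) M).IsIntegral (NormedField.valuation (K := OmegaSubfield 2 F)).integer]

/-- **Kernel ↔ kernel**: `toOmega P ∈ E₁(Ω) ↔ P ∈ E₁(F)`. [folklore] -/
theorem toOmegaF_mem_kernel_iff (P : (curveK 2 (OmegaSubfield 2 F) M).toAffine.Point) :
    toOmega 2 F M P ∈ kernel (Valued.v (R := PadicAlgCl 2)) (genFibΩ 2 M) ↔
      P ∈ kernel (NormedField.valuation (K := OmegaSubfield 2 F)) (curveK 2 (OmegaSubfield 2 F) M) := by
  rcases P with _ | ⟨x, y, h⟩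
  · exact ⟨fun _ ↦ (kernel (NormedField.valuation (K := OmegaSubfield 2 F)) (curveK 2 (OmegaSubfield 2 F) M)).zero_mem,
      fun _ ↦ (kernel (Valued.v (R := PadicAlgCl 2)) (genFibΩ 2 M)).zero_mem⟩
  · rw [OmegaSubfield.toOmega_some, some_mem_kernel_iff, some_mem_kernel_iff, PadicAlgCl.valuation_def, ← NNReal.coe_lt_coe, coe_nnnorm,
      NNReal.coe_one, norm_emb, ← NNReal.coe_lt_coe, NormedField.valuation_apply, coe_nnnorm, NNReal.coe_one]

omit hintΩ hint in
/-- `bLog` on `F`, viewed in `Ω`, is `bLogΩ` (`F` finite over `ℚ₂`). [folklore] -/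
theorem embF_bLog [FiniteDimensional ℚ_[2] ↥F] {t : OmegaSubfield 2 F} (ht : ‖t‖ < 1) :
    emb 2 F (bLog 2 (OmegaSubfield 2 F) M t) = bLogΩ 2 M (emb 2 F t) := by
  have h := (hasSum_qEval (K := OmegaSubfield 2 F) (norm_coeff_logQ_le (p := 2) (M := M)) ht).map
    (emb 2 F) continuous_emb
  have e : ((emb 2 F) ∘ fun n : ℕ ↦ algebraMap ℚ_[2] (OmegaSubfield 2 F) (coeff n (logQ 2 M)) * t ^ n) =
      fun n : ℕ ↦ algebraMap ℚ_[2] (PadicAlgCl 2) (coeff n (logQ 2 M)) * (emb 2 F t) ^ n := by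
    funext n
    simp only [Function.comp_apply, map_mul, map_pow, AlgHom.commutes]
  have h' := e ▸ h
  rw [bLogΩ, h'.tsum_eq]
  rfl

omit hintΩ in
/-- **`Λ_Ω(toOmega P) = Λ(P)`** for `P ∈ E₁(F)`. [folklore] -/
theorem ptLogΩ_toOmegaF [FiniteDimensional ℚ_[2] ↥F] {P : (curveK 2 (OmegaSubfield 2 F) M).toAffine.Point}
    (hP : P ∈ kernel (NormedField.valuation (K := OmegaSubfield 2 F)) (curveK 2 (OmegaSubfield 2 F) M)) :
    ptLogΩ 2 M (toOmega 2 F M P) = emb 2 F (ptLog 2 (OmegaSubfield 2 F) M P) := by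
  rw [ptLogΩ, zCoord_toOmegaF, ptLog, embF_bLog (norm_zCoord_lt_one hP)]

end Transport

/-! ## §3 The closure correspondence for a plus point -/

section Generation

variable {M : WeierstrassCurve ℤ_[2]} [hE : (M.map PadicInt.Coe.ringHom).IsElliptic] [hEt : (M.map PadicInt.toZMod).IsElliptic]
  [hintΩ : (genFibΩ 2 M).IsIntegral (Valued.v (R := PadicAlgCl 2)).integer]

omit hEt in
/-- **Closure correspondence along the plus tower**: for `e ∈ L(ℚ₂(v_{N+1})) ∩ E₁` with `Λ(e) − v_{N+1} ∈ ℚ₂(v_N)` (`N ≥ 2`),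
every `z ∈ ℤ[Γ·v_{N+1}]` is `Λ(B) (mod ℚ₂(v_N))` for some `B ∈ ℤ[Γ·e] ⊆ L(ℚ₂(v_{N+1})) ∩ E₁`. The plus analogue of
`exists_closure_pt'`. [cite: Kobayashi2003, Prop. 8.11] -/
theorem exists_closure_pt_plus
    (act : absoluteGaloisGroup ℚ_[2] → (genFibΩ 2 M).toAffine.Point → (genFibΩ 2 M).toAffine.Point)
    (hact0 : ∀ σ, act σ 0 = 0)
    (hact : ∀ σ (x y : PadicAlgCl 2) (h : (genFibΩ 2 M).toAffine.Nonsingular x y),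
      ∃ h', act σ (Affine.Point.some x y h) = Affine.Point.some (σ • x) (σ • y) h')
    {N : ℕ} (hN : 2 ≤ N) {e : (genFibΩ 2 M).toAffine.Point}
    (heL : e ∈ subfieldPoints (genFibΩ 2 M) (ℚ_[2]⟮zeta 2 (N + 1) + (zeta 2 (N + 1))⁻¹ - 2⟯).toSubfield
      (coeffs_mem_adjoin M _))
    (hek : e ∈ kernel (Valued.v (R := PadicAlgCl 2)) (genFibΩ 2 M))
    (heℓ : ptLogΩ 2 M e - (zeta 2 (N + 1) + (zeta 2 (N + 1))⁻¹ - 2) ∈ ℚ_[2]⟮zeta 2 N + (zeta 2 N)⁻¹ - 2⟯)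
    {z : PadicAlgCl 2}
    (hz : z ∈ AddSubgroup.closure
      (Set.range fun σ : absoluteGaloisGroup ℚ_[2] ↦ σ • (zeta 2 (N + 1) + (zeta 2 (N + 1))⁻¹ - 2))) :
    ∃ B ∈ AddSubgroup.closure (Set.range fun σ : absoluteGaloisGroup ℚ_[2] ↦ act σ e),
      B ∈ subfieldPoints (genFibΩ 2 M) (ℚ_[2]⟮zeta 2 (N + 1) + (zeta 2 (N + 1))⁻¹ - 2⟯).toSubfield
          (coeffs_mem_adjoin M _) ∧
        B ∈ kernel (Valued.v (R := PadicAlgCl 2)) (genFibΩ 2 M) ∧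
          ptLogΩ 2 M B - z ∈ ℚ_[2]⟮zeta 2 N + (zeta 2 N)⁻¹ - 2⟯ := by
  haveI := isIntegral_curveK 2 (LayerField 2 (N + 1)) M
  set v' := zeta 2 (N + 1) + (zeta 2 (N + 1))⁻¹ - 2 with hv'
  set k := ℚ_[2]⟮zeta 2 N + (zeta 2 N)⁻¹ - 2⟯ with hk
  set k' := ℚ_[2]⟮v'⟯ with hk'
  have hle : k'.toSubfield ≤ (layer 2 (N + 1)).toSubfield := adjoin_v_le_layer (N + 1)
  have hcz : ‖e.zCoord‖ < 1 := by
    have := val_zCoord_lt_one hek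
    rwa [PadicAlgCl.valuation_def, ← NNReal.coe_lt_coe, coe_nnnorm, NNReal.coe_one] at this
  induction hz using AddSubgroup.closure_induction with
  | mem x hx =>
    obtain ⟨σ, rfl⟩ := hx
    refine ⟨act σ e, AddSubgroup.subset_closure ⟨σ, rfl⟩,
      act_mem_subfieldPoints_adjoin_v act hact0 hact σ (by omega) heL, act_mem_kernel act hact0 hact σ hek, ?_⟩
    rw [ptLogΩ_act act hact0 hact σ hcz, ← smul_sub]
    exact smul_mem_adjoin_v hN σ heℓ
  | zero =>
    refine ⟨0, AddSubgroup.zero_mem _, (subfieldPoints _ _ _).zero_mem,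
      (kernel (Valued.v (R := PadicAlgCl 2)) (genFibΩ 2 M)).zero_mem, ?_⟩
    rw [ptLogΩ_zero, sub_zero]; exact IntermediateField.zero_mem _
  | add x y _ _ ihx ihy =>
    obtain ⟨B₁, hB₁, hB₁L, hB₁k, h₁⟩ := ihx
    obtain ⟨B₂, hB₂, hB₂L, hB₂k, h₂⟩ := ihy
    refine ⟨B₁ + B₂, AddSubgroup.add_mem _ hB₁ hB₂, (subfieldPoints _ _ _).add_mem hB₁L hB₂L,
      (kernel (Valued.v (R := PadicAlgCl 2)) (genFibΩ 2 M)).add_mem hB₁k hB₂k, ?_⟩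
    rw [ptLogΩ_add (m := N + 1) (mem_subfieldPoints_of_le _ coeffs_mem_layer hle hB₁L)
      (mem_subfieldPoints_of_le _ coeffs_mem_layer hle hB₂L) hB₁k hB₂k]
    rw [show ptLogΩ 2 M B₁ + ptLogΩ 2 M B₂ - (x + y) = (ptLogΩ 2 M B₁ - x) + (ptLogΩ 2 M B₂ - y) by ring]
    exact IntermediateField.add_mem _ h₁ h₂
  | neg x _ ih =>
    obtain ⟨B, hB, hBL, hBk, h⟩ := ih
    refine ⟨-B, AddSubgroup.neg_mem _ hB, (subfieldPoints _ _ _).neg_mem hBL,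
      (kernel (Valued.v (R := PadicAlgCl 2)) (genFibΩ 2 M)).neg_mem hBk, ?_⟩
    have hneg : ptLogΩ 2 M (-B) = -ptLogΩ 2 M B := by
      have h0 := ptLogΩ_sub (m := N + 1) (subfieldPoints _ _ _).zero_mem
        (mem_subfieldPoints_of_le _ coeffs_mem_layer hle hBL)
        (kernel (Valued.v (R := PadicAlgCl 2)) (genFibΩ 2 M)).zero_mem hBk
      rw [zero_sub, ptLogΩ_zero, zero_sub] at h0
      exact h0
    rw [hneg, show -ptLogΩ 2 M B - -x = -(ptLogΩ 2 M B - x) by ring]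
    exact IntermediateField.neg_mem _ h

/-! ## §4 The generation step along the plus tower (log level) -/

/-- **KOBAYASHI'S GENERATION STEP ALONG THE PLUS TOWER AT `p = 2` (log level).** `M/ℤ₂` good supersingular with `a₂ = 0`,
`N ≥ 2`, `k = ℚ₂(v_N) ⊂ k' = ℚ₂(v_{N+1})`; `e ∈ L(k') ∩ E₁` a point with `Λ(e) − v_{N+1} ∈ k` (a plus Honda point); `P ∈ L(k') ∩ E₁`.
Then there are `B ∈ ℤ[Γ·e]` and `R ∈ L(k') ∩ E₁` with `P − B − 2•R ∈ L(k') ∩ E₁` and **`Λ(P − B − 2•R) ∈ k`**.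
Proof = the K3 lead's `exists_sub_closure_sub_smul_mem'` run INSIDE the complete field `↥k'`: (BR1) Honda at every prime +
FROB⁺ (`exists_norm_sq_sub_le`) give `Λ(P) = μ₀ + y`, `μ₀ ∈ k`, `y ∈ 𝒪_{k'}`; (DEC) TGEN (`exists_mem_closure_pow_sigma_add`, from the
tower lemma `(T)`) gives `y = z + ν + 2³y'`, `z ∈ ℤ[Γ·v_{N+1}]`, `ν ∈ 𝒪_k`; local surjectivity (`exists_ptLog_eq`) gives `R` with
`Λ(2•R) = 2³y'`; the closure correspondence §3 gives `B` with `Λ(B) ≡ z (mod k)`. [cite: Kobayashi2003, Prop. 8.11, Prop. 8.12] -/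
theorem exists_sub_closure_sub_two_smul_plus
    (htr : Literature.NumberTheory.EllipticCurves.HasseManin.tr (M.map PadicInt.toZMod) = 0)
    (act : absoluteGaloisGroup ℚ_[2] → (genFibΩ 2 M).toAffine.Point → (genFibΩ 2 M).toAffine.Point)
    (hact0 : ∀ σ, act σ 0 = 0)
    (hact : ∀ σ (x y : PadicAlgCl 2) (h : (genFibΩ 2 M).toAffine.Nonsingular x y),
      ∃ h', act σ (Affine.Point.some x y h) = Affine.Point.some (σ • x) (σ • y) h')
    {N : ℕ} (hN : 2 ≤ N) {e : (genFibΩ 2 M).toAffine.Point}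
    (heL : e ∈ subfieldPoints (genFibΩ 2 M) (ℚ_[2]⟮zeta 2 (N + 1) + (zeta 2 (N + 1))⁻¹ - 2⟯).toSubfield
      (coeffs_mem_adjoin M _))
    (hek : e ∈ kernel (Valued.v (R := PadicAlgCl 2)) (genFibΩ 2 M))
    (heℓ : ptLogΩ 2 M e - (zeta 2 (N + 1) + (zeta 2 (N + 1))⁻¹ - 2) ∈ ℚ_[2]⟮zeta 2 N + (zeta 2 N)⁻¹ - 2⟯)
    {P : (genFibΩ 2 M).toAffine.Point}
    (hP : P ∈ subfieldPoints (genFibΩ 2 M) (ℚ_[2]⟮zeta 2 (N + 1) + (zeta 2 (N + 1))⁻¹ - 2⟯).toSubfield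
      (coeffs_mem_adjoin M _))
    (hPk : P ∈ kernel (Valued.v (R := PadicAlgCl 2)) (genFibΩ 2 M)) :
    ∃ B ∈ AddSubgroup.closure (Set.range fun σ : absoluteGaloisGroup ℚ_[2] ↦ act σ e),
      ∃ R ∈ subfieldPoints (genFibΩ 2 M) (ℚ_[2]⟮zeta 2 (N + 1) + (zeta 2 (N + 1))⁻¹ - 2⟯).toSubfield
          (coeffs_mem_adjoin M _),
        R ∈ kernel (Valued.v (R := PadicAlgCl 2)) (genFibΩ 2 M) ∧
        P - B - 2 • R ∈ subfieldPoints (genFibΩ 2 M) (ℚ_[2]⟮zeta 2 (N + 1) + (zeta 2 (N + 1))⁻¹ - 2⟯).toSubfield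
          (coeffs_mem_adjoin M _) ∧
        P - B - 2 • R ∈ kernel (Valued.v (R := PadicAlgCl 2)) (genFibΩ 2 M) ∧
        ptLogΩ 2 M (P - B - 2 • R) ∈ ℚ_[2]⟮zeta 2 N + (zeta 2 N)⁻¹ - 2⟯ := by
  set v := zeta 2 N + (zeta 2 N)⁻¹ - 2 with hv
  set v' := zeta 2 (N + 1) + (zeta 2 (N + 1))⁻¹ - 2 with hv'
  set k := ℚ_[2]⟮v⟯ with hk
  set k' := ℚ_[2]⟮v'⟯ with hk'
  haveI : FiniteDimensional ℚ_[2] (↥k') :=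
    IntermediateField.adjoin.finiteDimensional (Algebra.IsIntegral.isIntegral v')
  haveI := isIntegral_curveK 2 (OmegaSubfield 2 k') M
  haveI := isIntegral_curveK 2 (LayerField 2 (N + 1)) M
  have hle : k'.toSubfield ≤ (layer 2 (N + 1)).toSubfield := adjoin_v_le_layer (N + 1)
  have hkk' : k ≤ k' := adjoin_v_le_adjoin_v_succ N
  -- lift `P` to the complete field `K = OmegaSubfield 2 k'`
  obtain ⟨PK, rfl⟩ := exists_toOmegaF_eq hP
  have hPKk : PK ∈ kernel (NormedField.valuation (K := OmegaSubfield 2 k')) (curveK 2 (OmegaSubfield 2 k') M) :=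
    (toOmegaF_mem_kernel_iff PK).mp hPk
  -- (BR1) `Λ(P) = μ₀ + y`, `μ₀ ∈ k`, `‖y‖ ≤ 1` — Honda at every prime + FROB⁺
  set K' : Subfield (OmegaSubfield 2 k') := Subfield.comap (emb 2 k').toRingHom k.toSubfield with hK'
  have hFrob : ∀ y : OmegaSubfield 2 k', ‖y‖ ≤ 1 →
      ∃ s ∈ K', ‖s‖ ≤ 1 ∧ ‖y ^ 2 - s‖ ≤ ‖((2 : ℕ) : OmegaSubfield 2 k')‖ := by
    intro y hy
    rw [← norm_emb] at hy
    obtain ⟨s, hsk, hs1, hys⟩ := exists_norm_sq_sub_le hN (emb_mem y) hy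
    refine ⟨mk 2 k' s (hkk' hsk), ?_, ?_, ?_⟩
    · change emb 2 k' (mk 2 k' s (hkk' hsk)) ∈ k.toSubfield
      rw [emb_mk]; exact hsk
    · rw [← norm_emb, emb_mk]; exact hs1
    · rw [← norm_emb, map_sub, map_pow, emb_mk, ← norm_emb (p := 2) (F := k') ((2 : ℕ) : OmegaSubfield 2 k'), map_natCast]
      exact_mod_cast hys
  obtain ⟨μ₀, hμ₀, hμ₀y⟩ := exists_mem_norm_ptLog_sub_le_one' htr K' hFrob hPKk
  set y : OmegaSubfield 2 k' := ptLog 2 (OmegaSubfield 2 k') M PK - μ₀ with hy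
  have hμ₀k : emb 2 k' μ₀ ∈ k := hμ₀
  have hy1 : ‖emb 2 k' y‖ ≤ 1 := by rw [norm_emb]; exact hμ₀y
  -- (DEC) `y = z + ν + 2³ y'` — TGEN, from the tower lemma `(T)`
  obtain ⟨σ₃, hσ₃⟩ := exists_sigma_three (by omega : 1 ≤ N + 1)
  obtain ⟨z, hz, ν, ⟨hνk, -⟩, y'Ω, ⟨hy'L, hy'1⟩, hdec⟩ :=
    exists_mem_closure_pow_sigma_add hN hσ₃ 3 (emb_mem y) hy1
  have hz' : z ∈ AddSubgroup.closure (Set.range fun σ : absoluteGaloisGroup ℚ_[2] ↦ σ • v') := by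
    refine AddSubgroup.closure_mono ?_ hz
    rintro _ ⟨i, rfl⟩
    refine ⟨(toAlgEquiv ℚ_[2]).symm (σ₃ ^ i), ?_⟩
    change ((toAlgEquiv ℚ_[2]).symm (σ₃ ^ i)) • v' = (σ₃ ^ i) v'
    rw [absoluteGaloisGroup.smul_def, MulEquiv.apply_symm_apply]
  -- local surjectivity: `2³ y' = Λ(2 • RK)` in `K`
  set y'K : OmegaSubfield 2 k' := mk 2 k' y'Ω hy'L with hy'K
  have h2 : ‖(2 : OmegaSubfield 2 k')‖ = 2⁻¹ := by
    rw [← norm_emb, map_ofNat, ← map_ofNat (algebraMap ℚ_[2] (PadicAlgCl 2)) 2, PadicAlgCl.norm_extends]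
    have := Padic.norm_p (p := 2)
    exact_mod_cast this
  have htarget : ‖(2 : OmegaSubfield 2 k') ^ 2 * y'K‖ ≤ 1 / 4 := by
    rw [norm_mul, norm_pow, h2]
    have hy'n : ‖y'K‖ ≤ 1 := by rw [hy'K, ← norm_emb, emb_mk]; exact hy'1
    calc (2⁻¹ : ℝ) ^ 2 * ‖y'K‖ ≤ (2⁻¹ : ℝ) ^ 2 * 1 := by gcongr
      _ = 1 / 4 := by norm_num
  obtain ⟨RK, hRKk, hΛR, -⟩ := exists_ptLog_eq (p := 2) (M := M) htarget
  have hΛpR : ptLog 2 (OmegaSubfield 2 k') M (2 • RK) = (2 : OmegaSubfield 2 k') ^ 3 * y'K := by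
    rw [ptLog_nsmul hRKk, hΛR]; push_cast; ring
  -- the `Γ`-combination of conjugates of `e`
  obtain ⟨B, hB, hBL, hBk, hBz⟩ := exists_closure_pt_plus act hact0 hact hN heL hek heℓ hz'
  set νB := ptLogΩ 2 M B - z with hνB
  -- assemble
  set R := toOmega 2 k' M RK with hR
  have hRL : R ∈ subfieldPoints (genFibΩ 2 M) k'.toSubfield (coeffs_mem_adjoin M _) := toOmegaF_mem_subfieldPoints RK
  have hRk : R ∈ kernel (Valued.v (R := PadicAlgCl 2)) (genFibΩ 2 M) := (toOmegaF_mem_kernel_iff RK).mpr hRKk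
  have hPL : toOmega 2 k' M PK ∈ subfieldPoints (genFibΩ 2 M) k'.toSubfield (coeffs_mem_adjoin M _) :=
    toOmegaF_mem_subfieldPoints PK
  have hPRL : toOmega 2 k' M PK - B - 2 • R ∈ subfieldPoints (genFibΩ 2 M) k'.toSubfield (coeffs_mem_adjoin M _) :=
    (subfieldPoints _ _ _).sub_mem ((subfieldPoints _ _ _).sub_mem hPL hBL) ((subfieldPoints _ _ _).nsmul_mem hRL _)
  have hpRk : 2 • R ∈ kernel (Valued.v (R := PadicAlgCl 2)) (genFibΩ 2 M) :=
    (kernel (Valued.v (R := PadicAlgCl 2)) (genFibΩ 2 M)).nsmul_mem hRk _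
  have hPRk : toOmega 2 k' M PK - B - 2 • R ∈ kernel (Valued.v (R := PadicAlgCl 2)) (genFibΩ 2 M) :=
    (kernel (Valued.v (R := PadicAlgCl 2)) (genFibΩ 2 M)).sub_mem
      ((kernel (Valued.v (R := PadicAlgCl 2)) (genFibΩ 2 M)).sub_mem hPk hBk) hpRk
  refine ⟨B, hB, R, hRL, hRk, hPRL, hPRk, ?_⟩
  -- the logarithm of `P − B − 2•R`
  have hΛP : ptLogΩ 2 M (toOmega 2 k' M PK) = emb 2 k' μ₀ + emb 2 k' y := by
    rw [ptLogΩ_toOmegaF hPKk, hy, ← map_add]; congr 1; ring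
  have hΛpR' : ptLogΩ 2 M (2 • R) = (2 : PadicAlgCl 2) ^ 3 * y'Ω := by
    rw [hR, ← map_nsmul, ptLogΩ_toOmegaF ((kernel (NormedField.valuation (K := OmegaSubfield 2 k'))
      (curveK 2 (OmegaSubfield 2 k') M)).nsmul_mem hRKk _), hΛpR, map_mul, map_pow, map_ofNat, hy'K, emb_mk]
  rw [ptLogΩ_sub (m := N + 1) (mem_subfieldPoints_of_le _ coeffs_mem_layer hle ((subfieldPoints _ _ _).sub_mem hPL hBL))
      (mem_subfieldPoints_of_le _ coeffs_mem_layer hle ((subfieldPoints _ _ _).nsmul_mem hRL _))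
      ((kernel (Valued.v (R := PadicAlgCl 2)) (genFibΩ 2 M)).sub_mem hPk hBk) hpRk,
    ptLogΩ_sub (m := N + 1) (mem_subfieldPoints_of_le _ coeffs_mem_layer hle hPL)
      (mem_subfieldPoints_of_le _ coeffs_mem_layer hle hBL) hPk hBk, hΛP, hΛpR']
  have eB : ptLogΩ 2 M B = z + νB := by rw [hνB]; ring
  rw [eB]
  have e : emb 2 k' μ₀ + emb 2 k' y - (z + νB) - (2 : PadicAlgCl 2) ^ 3 * y'Ω =
      emb 2 k' μ₀ + ν - νB + (emb 2 k' y - (z + ν + 2 ^ 3 * y'Ω)) := by ring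
  rw [e, ← hdec, sub_self, add_zero]
  exact IntermediateField.sub_mem _ (IntermediateField.add_mem _ hμ₀k hνk) hBz

end Generation

end Summit.BirchSwinnertonDyer.BirchSwinnertonDyer.Theorems.SignedEC.PlusTower

end
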